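import Summits.AtomisticToContinuum.BoseEinsteinCondensation.Theorems.BECInsertionCorrectorStaticResponseBoundSectorFloorToHMinusOnePart1
import Literature.MathematicalPhysics.QuantumManyBody.PeriodicBoseGasTagged
import Literature.MathematicalPhysics.QuantumManyBody.PeriodicBoseGasFracEnergy
import Literature.MathematicalPhysics.QuantumManyBody.PeriodicKineticBudget
import HarnessLib

/-!
# Line `insertion-mode-gaussian-domination`, stub S4 `stub_modeCount` — Parseval bookkeeping on the torus
# (crux `BECInsertionCorrector.CorrectorClosure`, item stmt-AtomisticToContinuum-12058; auxiliary file 2 of 3)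

Supports (does not close) stmt-AtomisticToContinuum-12058. The `ℝ≥0∞` / `tsum` side of the `d = 3` mode count
for the TAGGED zero-mode occupation `f₀ = taggedZeroModeOccupation N L Ψ = n_0/(N+1)` of an `(N+1)`-body periodic
trial state (`BECInsertionCorrectorCorrectorClosureModeCount.lean` consumes it):

* `modeCount_tagged_ge` — the counting step in abstract form (architecture of [KLS1988PRL], as in
  `LaplacianModeCounting.condensate_ge_half_sq`): an infrared profile `n_k ≤ g(k)` on a finite window `S` with
  `∑_S g ≤ (N+1)/8`, a dispersion floor `D ≤ |2πk/L|²` off the window and the kinetic Chebyshev budget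
  `D⁻¹⟨Ψ, HΨ⟩ ≤ (N+1)/8` give, by Parseval `∑_k n_k = N+1` and `∑_k |2πk/L|² n_k = ∫|∇Ψ|² ≤ ⟨Ψ,HΨ⟩`,
  `n_0 ≥ (N+1)·3/4`, i.e. `f₀ ≥ 3/4`;
* the window geometry (`‖c·k‖² = c²|k|₂²` is the tree's `b1_norm_latticeVec_sq`): window modes lie in the cube
  of radius `⌊√W/c⌋₊` (`modeCount_mem_box_of_window`), the cube bounds the sup norm
  (`modeCount_supNorm_le_of_mem_box`), and the dispersion `fracDispersion 2 L k` is `ofReal ‖(2π/L)·k‖²`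
  (`modeCount_fracDispersion_two_eq`).

References (shape only): T. Kennedy, E. H. Lieb, B. S. Shastry, Phys. Rev. Lett. 61 (1988) 2582, (5)–(9);
LSSY2005 §1.2 (1.17)–(1.19).
-/

noncomputable section

open MeasureTheory
open scoped ENNReal NNReal BigOperators

namespace Summit.AtomisticToContinuum.BoseEinsteinCondensation.Theorems.CorrectorClosure.InsertionModeGaussianDomination

open Literature.MathematicalPhysics.QuantumManyBody.BoseGas
open Summit.AtomisticToContinuum.BoseEinsteinCondensation.Cruxes.StaticResponseBound.StableFractionSquareCompletion
  (b1_norm_latticeVec_sq)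

/-! ### Window geometry on `ℤ³` -/

/-- The free dispersion at `α = 2` is `ofReal ‖(2π/L)·k‖²`. [folklore] -/
theorem modeCount_fracDispersion_two_eq {L : ℝ} (hL : L ≠ 0) (k : Fin 3 → ℤ) :
    fracDispersion 2 L k = ENNReal.ofReal (‖latticeVec (2 * Real.pi / L) k‖ ^ 2) := by
  rw [fracDispersion_two, b1_norm_latticeVec_sq]
  congr 1
  field_simp
  ring

/-- In the cube `{-M, …, M}³` the sup norm is at most `M`. [folklore] -/
theorem modeCount_supNorm_le_of_mem_box {M : ℕ} {k : Fin 3 → ℤ}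
    (hk : k ∈ Fintype.piFinset fun _ : Fin 3 => Finset.Icc (-(M : ℤ)) (M : ℤ)) :
    (Finset.univ.sup fun j => (k j).natAbs) ≤ M := by
  refine Finset.sup_le fun j _ => ?_
  have h := Fintype.mem_piFinset.1 hk j
  rw [Finset.mem_Icc] at h
  omega

/-- A window mode `c²|k|₂² ≤ W` (`c > 0`) lies in the cube of radius `⌊√W/c⌋₊`. [folklore] -/
theorem modeCount_mem_box_of_window {c W : ℝ} (hc : 0 < c) {k : Fin 3 → ℤ}
    (hk : c ^ 2 * ∑ j, ((k j : ℤ) : ℝ) ^ 2 ≤ W) :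
    k ∈ Fintype.piFinset fun _ : Fin 3 =>
      Finset.Icc (-(⌊Real.sqrt W / c⌋₊ : ℤ)) (⌊Real.sqrt W / c⌋₊ : ℤ) := by
  have hW : 0 ≤ W := le_trans (by positivity) hk
  have hR : 0 ≤ Real.sqrt W / c := by positivity
  have hq : ∑ j, ((k j : ℤ) : ℝ) ^ 2 ≤ (Real.sqrt W / c) ^ 2 := by
    rw [div_pow, Real.sq_sqrt hW, le_div_iff₀ (by positivity)]
    linarith
  refine Fintype.mem_piFinset.2 fun j => Finset.mem_Icc.2 ?_
  have hj : ((k j : ℤ) : ℝ) ^ 2 ≤ (Real.sqrt W / c) ^ 2 :=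
    le_trans (Finset.single_le_sum (f := fun i => ((k i : ℤ) : ℝ) ^ 2) (fun i _ => sq_nonneg _)
      (Finset.mem_univ j)) hq
  have habs : |((k j : ℤ) : ℝ)| ≤ Real.sqrt W / c := by
    rw [← Real.sqrt_sq_eq_abs, ← Real.sqrt_sq hR]
    exact Real.sqrt_le_sqrt hj
  have h1 : (((k j).natAbs : ℕ) : ℝ) ≤ Real.sqrt W / c := by
    rw [Nat.cast_natAbs, Int.cast_abs]; exact habs
  have h2 : (k j).natAbs ≤ ⌊Real.sqrt W / c⌋₊ := Nat.le_floor h1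
  omega

/-! ### The counting step for the tagged zero-mode occupation -/

/-- **Mode counting on the torus for the tagged zero mode (abstract form).** Let `Ψ` be a periodic
`(N+1)`-body state on the torus of side `L`, `n_k = ⟨φ_k, γ_Ψ φ_k⟩` its plane-wave occupations, `S ∌ 0` a
finite window with an infrared profile `n_k ≤ g(k)` (`k ∈ S`, `g ≥ 0`, `∑_S g ≤ (N+1)/8`), and `D ∈ (0, ∞)` a
dispersion floor off the window (`D ≤ |2πk/L|²` for `k ∉ S`, `k ≠ 0`) with `D⁻¹⟨Ψ,HΨ⟩ ≤ (N+1)/8`. Then the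
tagged zero-mode occupation is `≥ 3/4`: by Parseval `N+1 = ∑_k n_k ≤ n_0 + ∑_S g + D⁻¹∑_k|2πk/L|²n_k ≤
n_0 + (N+1)/4` and `n_0 = (N+1)·f₀`. [cite: LSSY2005, §1.2 (1.17)–(1.19)] -/
theorem modeCount_tagged_ge {N : ℕ} {L : ℝ} (hL : 0 < L) (v : ℝ → ℝ≥0∞)
    (Ψ : PeriodicTrialState (N + 1) L) (S : Finset (Fin 3 → ℤ))
    (g : (Fin 3 → ℤ) → ℝ) (hg : ∀ k ∈ S, 0 ≤ g k) {D : ℝ≥0∞} (hD0 : D ≠ 0) (hDtop : D ≠ ⊤)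
    (hIR : ∀ k ∈ S, cellOccupation (N + 1) L (planeWaveMode L k) Ψ.ψ ≤ ENNReal.ofReal (g k))
    (hUV : ∀ k, k ≠ 0 → k ∉ S → D ≤ fracDispersion 2 L k)
    (hT : D⁻¹ * periodicEnergy v Ψ ≤ ENNReal.ofReal (((N : ℝ) + 1) / 8))
    (hW : ∑ k ∈ S, g k ≤ ((N : ℝ) + 1) / 8) :
    ENNReal.ofReal (3 / 4) ≤ taggedZeroModeOccupation N L Ψ.ψ := by
  classical
  set n : (Fin 3 → ℤ) → ℝ≥0∞ := fun k => cellOccupation (N + 1) L (planeWaveMode L k) Ψ.ψ with hn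
  -- pointwise three-way bound: zero mode / infrared window / ultraviolet tail
  have hpt : ∀ k, n k ≤ (if k = 0 then n k else 0) +
      (if k ∈ S then ENNReal.ofReal (g k) else 0) + D⁻¹ * (fracDispersion 2 L k * n k) := by
    intro k
    by_cases hk0 : k = 0
    · rw [if_pos hk0]
      exact le_add_right (le_add_right le_rfl)
    · by_cases hkS : k ∈ S
      · rw [if_neg hk0, if_pos hkS, zero_add]
        exact le_add_right (hIR k hkS)
      · refine le_add_left ?_
        calc n k = D⁻¹ * D * n k := by rw [ENNReal.inv_mul_cancel hD0 hDtop, one_mul]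
          _ ≤ D⁻¹ * fracDispersion 2 L k * n k := by gcongr; exact hUV k hk0 hkS
          _ = D⁻¹ * (fracDispersion 2 L k * n k) := mul_assoc _ _ _
  -- the infrared window carries at most `(N+1)/8`
  have hIRsum : ∑ k ∈ S, ENNReal.ofReal (g k) ≤ ENNReal.ofReal (((N : ℝ) + 1) / 8) := by
    rw [← ENNReal.ofReal_sum_of_nonneg hg]
    exact ENNReal.ofReal_le_ofReal hW
  -- the ultraviolet tail carries at most `(N+1)/8`
  have hTsum : D⁻¹ * ∑' k, fracDispersion 2 L k * n k ≤ ENNReal.ofReal (((N : ℝ) + 1) / 8) := by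
    refine le_trans ?_ hT
    gcongr
    calc ∑' k, fracDispersion 2 L k * n k = ∫⁻ X in cellN (N + 1) L, kineticDensity Ψ.ψ X :=
          tsum_fracDispersion_two_mul_cellOccupation hL Ψ
      _ ≤ periodicEnergy v Ψ := lintegral_kineticDensity_le_periodicEnergy v Ψ
  -- Parseval and summation of the pointwise bound
  have hS' : ∑ k ∈ S, (if k ∈ S then ENNReal.ofReal (g k) else 0) = ∑ k ∈ S, ENNReal.ofReal (g k) :=
    Finset.sum_congr rfl fun k hk => if_pos hk
  have hsum : ((N : ℝ≥0∞) + 1) ≤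
      n 0 + ENNReal.ofReal (((N : ℝ) + 1) / 8) + ENNReal.ofReal (((N : ℝ) + 1) / 8) := by
    calc ((N : ℝ≥0∞) + 1) = ∑' k, n k := by
          exact_mod_cast (Ψ.tsum_cellOccupation_planeWaveMode hL).symm
      _ ≤ ∑' k, ((if k = 0 then n k else 0) + (if k ∈ S then ENNReal.ofReal (g k) else 0) +
            D⁻¹ * (fracDispersion 2 L k * n k)) := ENNReal.tsum_le_tsum hpt
      _ = n 0 + ∑ k ∈ S, ENNReal.ofReal (g k) + D⁻¹ * ∑' k, fracDispersion 2 L k * n k := by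
          rw [ENNReal.tsum_add, ENNReal.tsum_add, tsum_ite_eq 0 n, ENNReal.tsum_mul_left,
            tsum_eq_sum (s := S) fun k hk => if_neg hk, hS']
      _ ≤ n 0 + ENNReal.ofReal (((N : ℝ) + 1) / 8) + ENNReal.ofReal (((N : ℝ) + 1) / 8) := by
          gcongr
  -- arithmetic: `(N+1)·3/4 + (N+1)/4 = N+1 ≤ (N+1) f₀ + (N+1)/4`
  have hquarter : ENNReal.ofReal (((N : ℝ) + 1) / 8) + ENNReal.ofReal (((N : ℝ) + 1) / 8) =
      ENNReal.ofReal (((N : ℝ) + 1) / 4) := by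
    rw [← ENNReal.ofReal_add (by positivity) (by positivity)]
    exact congrArg ENNReal.ofReal (by ring)
  have hsplit : ((N : ℝ≥0∞) + 1) * ENNReal.ofReal (3 / 4) + ENNReal.ofReal (((N : ℝ) + 1) / 4) =
      ((N : ℝ≥0∞) + 1) := by
    have h1 : ((N : ℝ≥0∞) + 1) = ENNReal.ofReal ((N : ℝ) + 1) := by
      rw [ENNReal.ofReal_add (by positivity) zero_le_one, ENNReal.ofReal_natCast, ENNReal.ofReal_one]
    rw [h1, ← ENNReal.ofReal_mul (by positivity), ← ENNReal.ofReal_add (by positivity) (by positivity)]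
    exact congrArg ENNReal.ofReal (by ring)
  have h0 : n 0 = ((N : ℝ≥0∞) + 1) * taggedZeroModeOccupation N L Ψ.ψ := by
    show cellOccupation (N + 1) L (planeWaveMode L 0) Ψ.ψ = _
    rw [cellOccupation_planeWaveMode_zero, succ_mul_taggedZeroModeOccupation hL]
  have key : ((N : ℝ≥0∞) + 1) * ENNReal.ofReal (3 / 4) + ENNReal.ofReal (((N : ℝ) + 1) / 4) ≤
      ((N : ℝ≥0∞) + 1) * taggedZeroModeOccupation N L Ψ.ψ + ENNReal.ofReal (((N : ℝ) + 1) / 4) := by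
    calc ((N : ℝ≥0∞) + 1) * ENNReal.ofReal (3 / 4) + ENNReal.ofReal (((N : ℝ) + 1) / 4)
        = ((N : ℝ≥0∞) + 1) := hsplit
      _ ≤ n 0 + ENNReal.ofReal (((N : ℝ) + 1) / 8) + ENNReal.ofReal (((N : ℝ) + 1) / 8) := hsum
      _ = ((N : ℝ≥0∞) + 1) * taggedZeroModeOccupation N L Ψ.ψ + ENNReal.ofReal (((N : ℝ) + 1) / 4) := by
          rw [add_assoc, hquarter, h0]
  have hN0 : ((N : ℝ≥0∞) + 1) ≠ 0 := by positivity
  have hNtop : ((N : ℝ≥0∞) + 1) ≠ ⊤ := ENNReal.add_ne_top.2 ⟨ENNReal.natCast_ne_top N, ENNReal.one_ne_top⟩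
  exact (ENNReal.mul_le_mul_iff_right hN0 hNtop).1 (ENNReal.le_of_add_le_add_right ENNReal.ofReal_ne_top key)

end Summit.AtomisticToContinuum.BoseEinsteinCondensation.Theorems.CorrectorClosure.InsertionModeGaussianDomination

end
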